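import Summits.KontsevichZagierPeriods.Zeta5Search.Criteria
import Summits.KontsevichZagierPeriods.Zeta5Search.ApproximationCertificate
import Summits.KontsevichZagierPeriods.Zeta5Search.RecurrenceGrowth
import HarnessLib

/-!
# ζ(5) search — `RecurrenceCertificate`: FORMAT A from finitary recurrence data (cell `pub-zeta5`, TYPER)

HONEST FRAMING: systematic search; no irrationality claim unless certified.

The wrapper promised in `CRITERIA.md` (FORMAT A, instantiation recipe): a candidate of the search
that comes as a SECOND-ORDER recurrence `y (n+2) = s n · y (n+1) - t n · y n` with two rational
solutions `u, v` is certified by the following FINITARY data, each item a statement the kernel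
checks on concrete polynomials/rationals (via `PolyPositivity.lean`) — except the two genuinely
mathematical inputs, the identification of the limit `v n / u n → ξ` and the integrality
`D n u n, D n v n ∈ ℤ` with `D n = ∏ᵢ lcm(1..cᵢ n)^{kᵢ}` (a theorem about the family):

* brackets `1 < λ ≤ Λ` (rationals) for the dominant root with the two inequalities
  `λ + t n/λ ≤ s n ≤ Λ + t n/Λ` for `n ≥ N`, `0 < t n ≤ τ` for `n ≥ N`, and the initial data
  `u N > 0`, `λ u N ≤ u (N+1) ≤ Λ u N`, `u N v (N+1) ≠ u (N+1) v N`;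
* the MARGIN in multiplicative form `e^{δ₀} · Λ · τ < λ²` with `δ₀ = ∑ᵢ cᵢ kᵢ ∈ ℕ` (prime number
  theorem in the tree; no `ε` bookkeeping is left to the user: the strict inequality supplies it).

`RecurrenceCertificate.toApproximationCertificate` builds the `ApproximationCertificate ξ` of
`ApproximationCertificate.lean` (growth by the ratio induction of `RecurrenceGrowth.lean`,
Casoratian by Abel's formula `W n = (∏ t i) W N`, denominators by
`eventually_prod_lcmUpto_pow_le_exp`), and `RecurrenceCertificate.irrational : Irrational ξ`.
In the cell's units: `Q ≈ log λ ≈ log Λ`, `w = log τ`, `δ = δ₀`, margin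
`μ₁ = 2 log λ - log Λ - log τ - δ₀ > 0`.

Everything is PROVED (no `sorry`, no named fact). Third-order families (Zudilin 2002,
Brown–Zudilin) use `RecurrenceGrowthOrderThree.lean` for the same fields; a wrapper for them is
not attempted here (the Casoratian is then itself a solution of an order-3 recurrence).
-/

noncomputable section

open Filter Topology Finset
open Literature.NumberTheory.Transcendental

namespace Summit.KontsevichZagierPeriods.Zeta5Search

/-- **Finitary recurrence certificate for `ξ`** (cell `CRITERIA.md`, FORMAT A, second order).
Two rational solutions `u, v` of `y (n+2) = s n y (n+1) - t n y n` (`n ≥ N`), rational brackets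
`1 < λ ≤ Λ` with `λ + t n/λ ≤ s n ≤ Λ + t n/Λ` and `0 < t n ≤ τ` for `n ≥ N`, initial data at `N`,
denominators `D n = ∏ᵢ lcm(1..cᵢ n)^{kᵢ}` with `D n u n, D n v n ∈ ℤ` for `n ≥ N`, the limit
`v n/u n → ξ`, and the margin `e^{∑ cᵢ kᵢ} Λ τ < λ²`. Then `ξ ∉ ℚ` (`RecurrenceCertificate.irrational`). -/
structure RecurrenceCertificate (ξ : ℝ) where
  /-- the coefficient solution `u n` (`D n u n ∈ ℤ`; Apéry's `b_n`) -/
  u : ℕ → ℚ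
  /-- the second solution `v n`, `v n / u n → ξ` (Apéry's `a_n`) -/
  v : ℕ → ℚ
  /-- recurrence coefficient `s n` (`= P₁(n)/P₂(n)`) -/
  s : ℕ → ℚ
  /-- recurrence coefficient `t n` (`= P₀(n)/P₂(n)`) -/
  t : ℕ → ℚ
  /-- threshold index from which all inequalities hold -/
  N : ℕ
  /-- lower bracket `λ` of the dominant root -/
  lam : ℚ
  /-- upper bracket `Λ` of the dominant root -/
  Lam : ℚ
  /-- upper bound `τ` for `t n` -/
  tau : ℚ
  /-- number of `lcm` factors in the denominator -/
  m : ℕ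
  /-- the scales `cᵢ` of `D n = ∏ᵢ lcm(1..cᵢ n)^{kᵢ}` -/
  c : Fin m → ℕ
  /-- the exponents `kᵢ` of `D n = ∏ᵢ lcm(1..cᵢ n)^{kᵢ}` -/
  k : Fin m → ℕ
  /-- `u` solves the recurrence for `n ≥ N` -/
  rec_u : ∀ n, N ≤ n → u (n + 2) = s n * u (n + 1) - t n * u n
  /-- `v` solves the recurrence for `n ≥ N` -/
  rec_v : ∀ n, N ≤ n → v (n + 2) = s n * v (n + 1) - t n * v n
  /-- `1 < λ` (the coefficients grow) -/
  one_lt_lam : 1 < lam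
  /-- `λ ≤ Λ` -/
  lam_le : lam ≤ Lam
  /-- `0 < t n` for `n ≥ N` (non-degenerate Casoratian) -/
  t_pos : ∀ n, N ≤ n → 0 < t n
  /-- `t n ≤ τ` for `n ≥ N` -/
  t_le : ∀ n, N ≤ n → t n ≤ tau
  /-- lower root bracket: `λ + t n/λ ≤ s n` for `n ≥ N` -/
  low : ∀ n, N ≤ n → lam + t n / lam ≤ s n
  /-- upper root bracket: `s n ≤ Λ + t n/Λ` for `n ≥ N` -/
  up : ∀ n, N ≤ n → s n ≤ Lam + t n / Lam
  /-- `u N > 0` -/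
  u_pos : 0 < u N
  /-- `λ u N ≤ u (N+1)` -/
  init_low : lam * u N ≤ u (N + 1)
  /-- `u (N+1) ≤ Λ u N` -/
  init_up : u (N + 1) ≤ Lam * u N
  /-- the Casoratian does not vanish at `N` -/
  casorati_init : u N * v (N + 1) - u (N + 1) * v N ≠ 0
  /-- `D n u n ∈ ℤ` for `n ≥ N` -/
  isInt_u : ∀ n, N ≤ n → ∃ z : ℤ, ((∏ i, Nat.lcmUpto (c i * n) ^ k i : ℕ) : ℚ) * u n = z
  /-- `D n v n ∈ ℤ` for `n ≥ N` -/
  isInt_v : ∀ n, N ≤ n → ∃ z : ℤ, ((∏ i, Nat.lcmUpto (c i * n) ^ k i : ℕ) : ℚ) * v n = z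
  /-- the identification of the limit: `v n / u n → ξ` -/
  tendsto_div : Tendsto (fun n : ℕ => (v n : ℝ) / (u n : ℝ)) atTop (𝓝 ξ)
  /-- the margin `e^{∑ cᵢ kᵢ} · Λ · τ < λ²` -/
  margin : Real.exp (∑ i, ((c i * k i : ℕ) : ℝ)) * Lam * tau < (lam : ℝ) ^ 2

namespace RecurrenceCertificate

variable {ξ : ℝ} (R : RecurrenceCertificate ξ)

/-- The denominator exponent `δ₀ = ∑ cᵢ kᵢ` (as a real number). -/
def denomRate₀ : ℝ := ∑ i, ((R.c i * R.k i : ℕ) : ℝ)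

/-- The margin `η = 2 log λ - log Λ - log τ - δ₀` of the certificate, in nats. -/
def eta : ℝ := 2 * Real.log R.lam - Real.log R.Lam - Real.log R.tau - R.denomRate₀

/-- The slack `ε = min (η/5) (log λ / 2)` used for all rates. -/
def eps : ℝ := min (R.eta / 5) (Real.log R.lam / 2)

/-- `λ > 0`. -/
theorem lam_pos : (0 : ℝ) < R.lam := by
  have h : (1 : ℝ) < R.lam := by exact_mod_cast R.one_lt_lam
  linarith

/-- `Λ > 0`. -/
theorem Lam_pos : (0 : ℝ) < R.Lam := by
  have h : (R.lam : ℝ) ≤ R.Lam := by exact_mod_cast R.lam_le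
  linarith [R.lam_pos]

/-- `τ > 0` (from `0 < t N ≤ τ`). -/
theorem tau_pos : (0 : ℝ) < R.tau := by
  have h1 := R.t_pos R.N le_rfl
  have h2 := R.t_le R.N le_rfl
  exact_mod_cast h1.trans_le h2

/-- `log λ > 0`. -/
theorem log_lam_pos : 0 < Real.log (R.lam : ℝ) := Real.log_pos (by exact_mod_cast R.one_lt_lam)

/-- The margin is positive: `η > 0` (logarithm of the multiplicative margin). -/
theorem eta_pos : 0 < R.eta := by
  have h := R.margin
  have hpos : 0 < Real.exp R.denomRate₀ * R.Lam * R.tau := by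
    have := R.Lam_pos; have := R.tau_pos; positivity
  have hlog := Real.log_lt_log hpos h
  rw [Real.log_mul (by have := R.Lam_pos; positivity) R.tau_pos.ne',
    Real.log_mul (Real.exp_pos _).ne' R.Lam_pos.ne', Real.log_exp, Real.log_pow] at hlog
  unfold eta
  push_cast at hlog
  linarith

/-- The slack `ε` is positive. -/
theorem eps_pos : 0 < R.eps := lt_min (by linarith [R.eta_pos]) (by linarith [R.log_lam_pos])

/-- `ε ≤ η/5`. -/
theorem eps_le_eta : R.eps ≤ R.eta / 5 := min_le_left _ _

/-- `ε ≤ log λ / 2`. -/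
theorem eps_le_log : R.eps ≤ Real.log R.lam / 2 := min_le_right _ _

/-- **Ratio bounds** (ratio induction of `RecurrenceGrowth.lean`, over `ℝ`): for `n ≥ N`,
`u n > 0` and `λ u n ≤ u (n+1) ≤ Λ u n`. -/
theorem ratio_bounds : ∀ n, R.N ≤ n → (0 : ℝ) < R.u n ∧
    (R.lam : ℝ) * R.u n ≤ R.u (n + 1) ∧ (R.u (n + 1) : ℝ) ≤ R.Lam * R.u n := by
  refine ratio_bounds_of_recurrence (fun n => (R.u n : ℝ)) (fun n => (R.s n : ℝ))
    (fun n => (R.t n : ℝ)) R.N ?_ ?_ R.lam_pos (by exact_mod_cast R.lam_le) ?_ ?_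
    (by exact_mod_cast R.u_pos) (by exact_mod_cast R.init_low) (by exact_mod_cast R.init_up)
  · intro n hn; exact_mod_cast R.rec_u n hn
  · intro n hn; exact_mod_cast (R.t_pos n hn).le
  · intro n hn; exact_mod_cast R.low n hn
  · intro n hn; exact_mod_cast R.up n hn

/-- **Abel's formula** for the certificate: `W n = (∏_{N ≤ i < n} t i) · W N` for `n ≥ N`. -/
theorem casoratian_eq (n : ℕ) (hn : R.N ≤ n) :
    R.u n * R.v (n + 1) - R.u (n + 1) * R.v n =
      (∏ i ∈ Ico R.N n, R.t i) * (R.u R.N * R.v (R.N + 1) - R.u (R.N + 1) * R.v R.N) :=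
  casoratian_eq_prod_mul R.u R.v R.s R.t R.N R.rec_u R.rec_v n hn

/-- The Casoratian never vanishes from `N` on. -/
theorem casoratian_ne_zero (n : ℕ) (hn : R.N ≤ n) :
    R.u n * R.v (n + 1) - R.u (n + 1) * R.v n ≠ 0 := by
  rw [R.casoratian_eq n hn]
  refine mul_ne_zero (prod_ne_zero_iff.2 fun i hi => ?_) R.casorati_init
  exact (R.t_pos i (mem_Ico.1 hi).1).ne'

/-- The Casoratian bound: `|W n| ≤ (|W N| / τ^N) · e^{(log τ) n}` for `n ≥ N`. -/
theorem abs_casoratian_le (n : ℕ) (hn : R.N ≤ n) :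
    |((R.u n * R.v (n + 1) - R.u (n + 1) * R.v n : ℚ) : ℝ)| ≤
      |((R.u R.N * R.v (R.N + 1) - R.u (R.N + 1) * R.v R.N : ℚ) : ℝ)| / (R.tau : ℝ) ^ R.N *
        Real.exp (Real.log R.tau * n) := by
  have hτ := R.tau_pos
  rw [R.casoratian_eq n hn]
  push_cast
  rw [abs_mul]
  -- `|∏ t i| ≤ τ^{n-N}`
  have hprod : |∏ i ∈ Ico R.N n, (R.t i : ℝ)| ≤ (R.tau : ℝ) ^ (n - R.N) := by
    rw [abs_prod]
    calc ∏ i ∈ Ico R.N n, |(R.t i : ℝ)| ≤ ∏ i ∈ Ico R.N n, (R.tau : ℝ) :=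
          prod_le_prod (fun i _ => abs_nonneg _) fun i hi => by
            rw [abs_of_pos (by exact_mod_cast R.t_pos i (mem_Ico.1 hi).1)]
            exact_mod_cast R.t_le i (mem_Ico.1 hi).1
      _ = (R.tau : ℝ) ^ (n - R.N) := by rw [prod_const, Nat.card_Ico]
  have hexp : Real.exp (Real.log R.tau * n) = (R.tau : ℝ) ^ n := by
    rw [mul_comm, Real.exp_nat_mul, Real.exp_log hτ]
  rw [hexp]
  have hpow : (R.tau : ℝ) ^ (n - R.N) = (R.tau : ℝ) ^ n / (R.tau : ℝ) ^ R.N := by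
    rw [eq_div_iff (pow_ne_zero _ hτ.ne'), ← pow_add, Nat.sub_add_cancel hn]
  calc |∏ i ∈ Ico R.N n, (R.t i : ℝ)| * |(R.u R.N : ℝ) * R.v (R.N + 1) - R.u (R.N + 1) * R.v R.N|
      ≤ (R.tau : ℝ) ^ (n - R.N) * |(R.u R.N : ℝ) * R.v (R.N + 1) - R.u (R.N + 1) * R.v R.N| :=
        mul_le_mul_of_nonneg_right hprod (abs_nonneg _)
    _ = |(R.u R.N : ℝ) * R.v (R.N + 1) - R.u (R.N + 1) * R.v R.N| / (R.tau : ℝ) ^ R.N *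
          (R.tau : ℝ) ^ n := by rw [hpow]; ring

/-- **The approximation certificate built from the recurrence data** (FORMAT A): growth exponents
`log λ - ε`, `log Λ + ε`, Casoratian rate `log τ`, denominator rate `δ₀ + ε`, with
`ε = min (η/5, log λ/2)`. -/
def toApproximationCertificate : ApproximationCertificate ξ where
  u := R.u
  v := R.v
  denom n := ∏ i, Nat.lcmUpto (R.c i * n) ^ R.k i
  growthLow := Real.log R.lam - R.eps
  growthUp := Real.log R.Lam + R.eps
  casoratiConst := |((R.u R.N * R.v (R.N + 1) - R.u (R.N + 1) * R.v R.N : ℚ) : ℝ)| /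
    (R.tau : ℝ) ^ R.N
  casoratiRate := Real.log R.tau
  denomRate := R.denomRate₀ + R.eps
  growthLow_pos := by linarith [R.eps_le_log, R.log_lam_pos]
  denom_pos n := prod_lcmUpto_pow_pos R.c R.k n
  isInt_u := eventually_atTop.2 ⟨R.N, R.isInt_u⟩
  isInt_v := eventually_atTop.2 ⟨R.N, R.isInt_v⟩
  growth_lower := eventually_exp_le_of_ratio (fun n => (R.u n : ℝ)) R.N R.lam_pos
    (by exact_mod_cast R.u_pos) (fun n hn => (R.ratio_bounds n hn).2.1)
    (by linarith [R.eps_pos])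
  growth_upper := eventually_le_exp_of_ratio (fun n => (R.u n : ℝ)) R.N R.Lam_pos
    (by exact_mod_cast R.u_pos) (fun n hn => (R.ratio_bounds n hn).2.2)
    (by linarith [R.eps_pos])
  casorati_le := eventually_atTop.2 ⟨R.N, R.abs_casoratian_le⟩
  casorati_ne := Eventually.frequently (eventually_atTop.2 ⟨R.N, R.casoratian_ne_zero⟩)
  tendsto_div := R.tendsto_div
  denom_le := by
    filter_upwards [eventually_prod_lcmUpto_pow_le_exp R.c R.k R.eps_pos] with n hn
    unfold denomRate₀
    exact_mod_cast hn
  margin := by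
    have h1 := R.eps_le_eta
    have h2 := R.eta_pos
    have e : R.eta = 2 * Real.log R.lam - Real.log R.Lam - Real.log R.tau - R.denomRate₀ := rfl
    linarith

/-- The margin of the built certificate is `η - 4ε ≥ η/5 > 0` (`η = 2 log λ - log Λ - log τ - δ₀`). -/
theorem marginValue_toApproximationCertificate :
    R.toApproximationCertificate.marginValue = R.eta - 4 * R.eps := by
  simp only [ApproximationCertificate.marginValue, toApproximationCertificate, eta]
  ring

/-- **Recurrence certificate ⇒ irrational.** -/
theorem irrational (R : RecurrenceCertificate ξ) : Irrational ξ :=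
  ApproximationCertificate.irrational R.toApproximationCertificate

end RecurrenceCertificate

/-! ### The two targets of the cell -/

/-- **`ζ(5)`**: a `RecurrenceCertificate` for `zetaValue 5` proves the tree's open statement
`ZetaFiveIrrational`. (Implication only; no certificate is constructed — every known `ζ(5)`
recurrence is third order with margin `< 0`, cf. `NEAR-MISSES.md`.) -/
theorem zetaFiveIrrational_of_recurrenceCertificate (R : RecurrenceCertificate (zetaValue 5)) :
    ZetaFiveIrrational :=
  R.irrational

/-- **Catalan's constant**: a `RecurrenceCertificate` for `catalanConstant` proves the tree's open
statement `CatalanIrrational`. (Implication only.) -/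
theorem catalanIrrational_of_recurrenceCertificate (R : RecurrenceCertificate catalanConstant) :
    CatalanIrrational :=
  R.irrational

end Summit.KontsevichZagierPeriods.Zeta5Search
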